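import Mathlib.Data.List.Sort
import Mathlib.Data.Prod.Lex
import Mathlib.Data.List.Lex
import Literature.Computability.Complexity.GraphCanonizationParts
import Literature.Computability.Complexity.ColourRefinementScheme
import HarnessLib

/-!
# The section/individualization canoniser of a vertex-coloured graph (after Corneil–Goldberg 1984)

The RECURSION of a simply-exponential canoniser of vertex-coloured graphs on `Fin k`, in the
style of Corneil–Goldberg [CorneilGoldberg1984] as recast by Laubner [Laubner2011, §3.4], on the
states `(W, c)` of `GraphCanonizationParts.lean`. Given a REFINER `R` (a label-invariant operator
returning an equitable refinement of the colouring on `W`, `CGCanon.Refiner`; the tree's ordered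
colour refinement is one, `GraphCanonizationRefiner.lean`), `CGCanon.canon R G W c : List (Fin k)`
is an ORDERING of `W` computed as follows ([Laubner2011, §3.4, steps 1–3 and Thm. 3.4.3], with the
one simplification that sections are taken ONLY along the components of the switched graph,
which is all the size analysis of `GraphCanonizationSchemeSize.lean` needs):

* `|W| ≤ 1`: the trivial ordering;
* the switched graph `swG G W c` is disconnected on `W` (SECTION node): order every component
  `K` recursively (state `(K, c)`), sort the components by the key
  `(code of the ordered part, sorted vertex list)` and concatenate (`CGCanon.paste`);
* connected (INDIVIDUALIZATION node): let `A` be the non-singleton cell of least `(size, colour)`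
  (`CGCanon.bigMinCell`; in an equitable connected state every cell is non-singleton); for each
  `x ∈ A` refine the colouring with `x` individualized (`individualize`, then `R.refine`), order
  `W` recursively in the refined state, and keep the ordering whose code WITH RESPECT TO `c` is
  least (ties by the vertex `x`).

`CGCanon.code G c ord` is the ordered coloured graph along `ord` (adjacency matrix rows and the
colour list, in the linear order `Lex (List (List Bool) × List ℕ)`). Termination: sections shrink
`W`, individualization strictly increases the number of colours on `W` (`card_image_individualize`,
`Refiner.card_image_le`). This file has the definitions, the termination facts and the unfolding
equations (`canon_of_card_le_one`, `canon_of_not_isConn`, `canon_of_isConn`); correctness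
(label-invariance, hence a canonical form) is `GraphCanonizationSchemeCorrect.lean`, the `C^k`
size bound `GraphCanonizationSchemeSize.lean`.

## References

* D. G. Corneil, M. K. Goldberg, *A non-factorial algorithm for canonical numbering of a graph*,
  J. Algorithms 5 (1984) 345–362. [CorneilGoldberg1984]
* B. Laubner, PhD thesis, HU Berlin 2011, doi:10.18452/16335, §3.4 (the recursion tree `T`,
  Thm. 3.4.3); read pp. 49–52. [Laubner2011]
* B. D. McKay, A. Piperno, *Practical graph isomorphism, II*, J. Symbolic Comput. 60 (2014),
  §2.3 (refinement functions, individualization). [MckayPiperno2014]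
-/

namespace Literature.Computability.Complexity

open Literature.Combinatorics.SimpleGraph Finset ColourRefinementScheme

open scoped Classical

noncomputable section

namespace CGCanon

variable {k : ℕ}

/-! ### Refiners -/

/-- A **refiner**: an operator `refine G W c` returning a colouring that, on `W`, refines `c`, is
equitable, and is LABEL-INVARIANT — along a relabelling `e` of `Fin k` (pullback form: the graph
`G.comap e`, the subset `W`, the colouring `c ∘ e` versus `G`, `W.map e`, `c`) the refined colours
correspond. The abstract datum of "a refinement function implemented in a label-invariant
manner" ([MckayPiperno2014, §2.3 (R1)–(R3), §3.1]) together with equitability of its output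
([Laubner2011, §3.4 step 1: "do colour refinement"]). [cite: MckayPiperno2014, §2.3] -/
structure Refiner (k : ℕ) where
  /-- The refinement operator. -/
  refine : SimpleGraph (Fin k) → Finset (Fin k) → (Fin k → ℕ) → (Fin k → ℕ)
  /-- On `W` the output refines the input. -/
  refines : ∀ (G : SimpleGraph (Fin k)) (W : Finset (Fin k)) (c : Fin k → ℕ) ⦃u v : Fin k⦄,
    u ∈ W → v ∈ W → refine G W c u = refine G W c v → c u = c v
  /-- The output is equitable on `W`. -/
  isEqui : ∀ (G : SimpleGraph (Fin k)) (W : Finset (Fin k)) (c : Fin k → ℕ), IsEqui G W (refine G W c)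
  /-- Label-invariance (pullback form), on `W`. -/
  equivariant : ∀ (G : SimpleGraph (Fin k)) (e : Equiv.Perm (Fin k)) (W : Finset (Fin k)) (c c' : Fin k → ℕ),
    (∀ v ∈ W, c' v = c (e v)) → ∀ v ∈ W, refine (G.comap e) W c' v = refine G (W.map e.toEmbedding) c (e v)

/-- Refining does not decrease the number of colours on `W`. [folklore] -/
theorem card_image_le_of_refines {W : Finset (Fin k)} {c c' : Fin k → ℕ}
    (h : ∀ ⦃u v : Fin k⦄, u ∈ W → v ∈ W → c' u = c' v → c u = c v) : (W.image c).card ≤ (W.image c').card := by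
  -- through the finset of pairs `(c v, c' v)`, on which the second projection is injective
  let T : Finset (ℕ × ℕ) := W.image fun v => (c v, c' v)
  have h1 : W.image c = T.image Prod.fst := by
    rw [image_image]; rfl
  have h2 : W.image c' = T.image Prod.snd := by
    rw [image_image]; rfl
  have hinj : Set.InjOn Prod.snd (T : Set (ℕ × ℕ)) := by
    rintro ⟨a, b⟩ hab ⟨a', b'⟩ hab' (hbb : b = b')
    obtain ⟨v, hv, hve⟩ := mem_image.1 (mem_coe.1 hab)
    obtain ⟨v', hv', hve'⟩ := mem_image.1 (mem_coe.1 hab')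
    simp only [Prod.mk.injEq] at hve hve'
    obtain ⟨rfl, rfl⟩ := hve
    obtain ⟨rfl, rfl⟩ := hve'
    exact Prod.ext (h hv hv' hbb) hbb
  rw [h1, h2, card_image_of_injOn hinj]
  exact card_image_le

/-- A refiner does not decrease the number of colours on `W`. [folklore] -/
theorem Refiner.card_image_le (R : Refiner k) (G : SimpleGraph (Fin k)) (W : Finset (Fin k)) (c : Fin k → ℕ) :
    (W.image c).card ≤ (W.image (R.refine G W c)).card :=
  card_image_le_of_refines (R.refines G W c)

/-- **Individualizing a vertex of a non-singleton cell adds exactly one colour on `W`** (`x` gets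
the fresh colour `0`, every other vertex keeps its class). [cite: MckayPiperno2014, §2.3 (individualization)] -/
theorem card_image_individualize {W : Finset (Fin k)} (c : Fin k → ℕ) {x : Fin k} (hx : x ∈ W) (h2 : 2 ≤ (cell W c x).card) :
    (W.image (individualize c x)).card = (W.image c).card + 1 := by
  have hsplit : W.image (individualize c x) = insert 0 ((W.erase x).image fun w => c w + 1) := by
    ext a
    simp only [mem_image, mem_insert, mem_erase, individualize]
    constructor
    · rintro ⟨w, hw, rfl⟩
      by_cases hwx : w = x
      · exact Or.inl (if_pos hwx)
      · exact Or.inr ⟨w, ⟨hwx, hw⟩, by rw [if_neg hwx]⟩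
    · rintro (rfl | ⟨w, ⟨hwx, hw⟩, rfl⟩)
      · exact ⟨x, hx, if_pos rfl⟩
      · exact ⟨w, hw, by rw [if_neg hwx]⟩
  have hnot : (0 : ℕ) ∉ (W.erase x).image fun w => c w + 1 := by simp
  -- the colour of `x` is still worn by another vertex of its cell
  obtain ⟨y, hy, hyx⟩ : ∃ y ∈ cell W c x, y ≠ x := by
    by_contra hno
    push Not at hno
    have : cell W c x ⊆ {x} := fun y hy => mem_singleton.2 (hno y hy)
    have := card_le_card this
    rw [card_singleton] at this
    omega
  have heq : (W.erase x).image c = W.image c := by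
    apply Subset.antisymm (image_subset_image (erase_subset _ _))
    intro a ha
    obtain ⟨w, hw, rfl⟩ := mem_image.1 ha
    by_cases hwx : w = x
    · subst hwx
      exact mem_image.2 ⟨y, mem_erase.2 ⟨hyx, (mem_cell.1 hy).1⟩, (mem_cell.1 hy).2⟩
    · exact mem_image.2 ⟨w, mem_erase.2 ⟨hwx, hw⟩, rfl⟩
  have hinj : ((W.erase x).image fun w => c w + 1) = ((W.erase x).image c).image (· + 1) := by
    rw [image_image]; rfl
  rw [hsplit, card_insert_of_notMem hnot, hinj, card_image_of_injective _ (fun a b h => Nat.succ_injective h), heq]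

/-! ### Codes of orderings -/

/-- The type of codes: adjacency-matrix rows and colour list, compared lexicographically. [folklore] -/
abbrev Code : Type := Lex (List (List Bool) × List ℕ)

/-- **The code of the ordering `ord`**: the ordered coloured graph `(G, c)` read along `ord` —
row `i` lists the adjacency bits of `ord[i]` against `ord[0], ord[1], …`, followed by the colours
`c (ord[0]), …`. [cite: Laubner2011, Thm. 3.4.3 (the ordered copy `C_P`)] -/
def code (G : SimpleGraph (Fin k)) (c : Fin k → ℕ) (ord : List (Fin k)) : Code :=
  toLex (ord.map fun u => ord.map fun v => decide (G.Adj u v), ord.map c)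

/-! ### Section nodes: pasting ordered parts -/

/-- The components of the switched graph of the state, as a finset of finsets. [cite: Laubner2011, §3.4 step 2] -/
def parts (G : SimpleGraph (Fin k)) (W : Finset (Fin k)) (c : Fin k → ℕ) : Finset (Finset (Fin k)) :=
  W.image (comp G W c)

/-- The sorting key of an ordered part: its code, then (to make the key injective) its sorted
vertex list. Only the code matters for the resulting code (`GraphCanonizationSchemeCorrect.lean`). [folklore] -/
def partKey (G : SimpleGraph (Fin k)) (c : Fin k → ℕ) (ordOf : Finset (Fin k) → List (Fin k)) (K : Finset (Fin k)) :
    Lex (Code × List ℕ) :=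
  toLex (code G c (ordOf K), (K.sort (· ≤ ·)).map Fin.val)

/-- The key preorder on parts is total. [folklore] -/
instance partKey_total (G : SimpleGraph (Fin k)) (c : Fin k → ℕ) (ordOf : Finset (Fin k) → List (Fin k)) :
    Std.Total fun K K' : Finset (Fin k) => partKey G c ordOf K ≤ partKey G c ordOf K' :=
  ⟨fun _ _ => le_total _ _⟩

/-- The key preorder on parts is transitive. [folklore] -/
instance partKey_trans (G : SimpleGraph (Fin k)) (c : Fin k → ℕ) (ordOf : Finset (Fin k) → List (Fin k)) :
    IsTrans (Finset (Fin k)) fun K K' => partKey G c ordOf K ≤ partKey G c ordOf K' :=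
  ⟨fun _ _ _ h h' => le_trans h h'⟩

/-- **Pasting**: sort the parts by key and concatenate their orderings (the key is injective on
a finset of parts, so the sorted list does not depend on the enumeration `toList`). [cite: Laubner2011, Thm. 3.4.3 (lexicographic disjoint union)] -/
def paste (G : SimpleGraph (Fin k)) (c : Fin k → ℕ) (P : Finset (Finset (Fin k))) (ordOf : Finset (Fin k) → List (Fin k)) :
    List (Fin k) :=
  (P.toList.insertionSort fun K K' => partKey G c ordOf K ≤ partKey G c ordOf K').flatMap ordOf

/-! ### Individualization nodes: the branching cell -/

/-- The key of a vertex for choosing the branching cell: (cell size, colour). [cite: Laubner2011, §3.4 step 3] -/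
def cellKey (W : Finset (Fin k)) (c : Fin k → ℕ) (v : Fin k) : Lex (ℕ × ℕ) := toLex ((cell W c v).card, c v)

/-- **The branching cell**: the vertices of `W` in non-singleton cells whose key (size, colour) is
least — the "smallest-index cell of smallest cardinality among the non-singleton cells"
([Laubner2011, §3.4 step 3]); empty iff every cell is a singleton. [cite: Laubner2011, §3.4 step 3] -/
def bigMinCell (W : Finset (Fin k)) (c : Fin k → ℕ) : Finset (Fin k) :=
  W.filter fun v => 2 ≤ (cell W c v).card ∧ ∀ w ∈ W, 2 ≤ (cell W c w).card → cellKey W c v ≤ cellKey W c w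

/-- Vertices of the branching cell lie in `W`, in non-singleton cells. [folklore] -/
theorem mem_bigMinCell {W : Finset (Fin k)} {c : Fin k → ℕ} {v : Fin k} :
    v ∈ bigMinCell W c ↔ v ∈ W ∧ 2 ≤ (cell W c v).card ∧ ∀ w ∈ W, 2 ≤ (cell W c w).card → cellKey W c v ≤ cellKey W c w := by
  simp [bigMinCell]

/-- The branching cell IS a cell: it is the cell of each of its elements. [folklore] -/
theorem bigMinCell_eq_cell {W : Finset (Fin k)} {c : Fin k → ℕ} {v : Fin k} (hv : v ∈ bigMinCell W c) :
    bigMinCell W c = cell W c v := by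
  obtain ⟨hvW, hv2, hvmin⟩ := mem_bigMinCell.1 hv
  ext w
  rw [mem_bigMinCell, mem_cell]
  constructor
  · rintro ⟨hwW, hw2, hwmin⟩
    have h := le_antisymm (hwmin v hvW hv2) (hvmin w hwW hw2)
    exact ⟨hwW, (Prod.ext_iff.1 (toLex.injective h)).2⟩
  · rintro ⟨hwW, hcw⟩
    have hcell : cell W c w = cell W c v := cell_eq_cell_of_eq hcw
    have hkey : cellKey W c w = cellKey W c v := by simp [cellKey, hcell, hcw]
    exact ⟨hwW, hcell ▸ hv2, fun u hu hu2 => hkey ▸ hvmin u hu hu2⟩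

/-- If some cell of `W` has at least two elements, the branching cell is nonempty. [folklore] -/
theorem bigMinCell_nonempty {W : Finset (Fin k)} {c : Fin k → ℕ} (h : ∃ v ∈ W, 2 ≤ (cell W c v).card) :
    (bigMinCell W c).Nonempty := by
  let S := W.filter fun v => 2 ≤ (cell W c v).card
  have hS : S.Nonempty := by
    obtain ⟨v, hv, hv2⟩ := h
    exact ⟨v, mem_filter.2 ⟨hv, hv2⟩⟩
  obtain ⟨v, hvS, hvmin⟩ := S.exists_min_image (cellKey W c) hS
  obtain ⟨hvW, hv2⟩ := mem_filter.1 hvS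
  exact ⟨v, mem_bigMinCell.2 ⟨hvW, hv2, fun w hw hw2 => hvmin w (mem_filter.2 ⟨hw, hw2⟩)⟩⟩

/-! ### The canoniser -/

/-- The children of an individualization node refine strictly: individualize `x` (a vertex of a
non-singleton cell) and refine. [folklore] -/
theorem measure_lt_of_mem_bigMinCell (R : Refiner k) (G : SimpleGraph (Fin k)) (W : Finset (Fin k)) (c : Fin k → ℕ)
    {x : Fin k} (hx : x ∈ bigMinCell W c) :
    W.card - (W.image (R.refine G W (individualize c x))).card < W.card - (W.image c).card := by
  obtain ⟨hxW, hx2, -⟩ := mem_bigMinCell.1 hx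
  have h1 := card_image_individualize c hxW hx2
  have h2 := R.card_image_le G W (individualize c x)
  have h3 : (W.image (R.refine G W (individualize c x))).card ≤ W.card := card_image_le
  omega

/-- Parts of a disconnected state are proper subsets. [folklore] -/
theorem card_lt_of_mem_parts {G : SimpleGraph (Fin k)} {W : Finset (Fin k)} {c : Fin k → ℕ} (h : ¬ IsConn G W c)
    {K : Finset (Fin k)} (hK : K ∈ parts G W c) : K.card < W.card := by
  obtain ⟨u, -, rfl⟩ := mem_image.1 hK
  exact card_lt_card (comp_ssubset_of_not_isConn h u)

/-- **The section/individualization canoniser** `canon R G W c`: an ordering of `W` (see the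
module docstring for the three cases). Well-founded on `(|W|, |W| - #colours on W)`.
[cite: Laubner2011, §3.4 (recursion tree, steps 1–3) and Thm. 3.4.3] -/
def canon (R : Refiner k) (G : SimpleGraph (Fin k)) : Finset (Fin k) → (Fin k → ℕ) → List (Fin k)
  | W, c =>
    if W.card ≤ 1 then W.sort (· ≤ ·)
    else if hconn : IsConn G W c then
      if hA : (bigMinCell W c).Nonempty then
        -- individualization: candidate (code w.r.t. `c`, vertex, ordering) for every `x` in the branching cell
        let cand : {x // x ∈ bigMinCell W c} → Lex (Code × Lex (ℕ × List (Fin k))) := fun x =>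
          have := measure_lt_of_mem_bigMinCell R G W c x.2
          let ord := canon R G W (R.refine G W (individualize c x.1))
          toLex (code G c ord, toLex (x.1.val, ord))
        (ofLex (ofLex (((bigMinCell W c).attach.image cand).min'
          ((attach_nonempty_iff.2 hA).image cand))).2).2
      else W.sort (· ≤ ·)
    else
      paste G c (parts G W c) fun K =>
        if hK : K ∈ parts G W c then
          have := card_lt_of_mem_parts hconn hK
          canon R G K c
        else []
termination_by W c => (W.card, W.card - (W.image c).card)
decreasing_by
  · exact Prod.Lex.right _ this
  · exact Prod.Lex.left _ _ this

/-! ### Unfolding the canoniser -/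

variable (R : Refiner k) (G : SimpleGraph (Fin k))

/-- The candidate attached to a branching vertex `x`: the code WITH RESPECT TO `c` of the
ordering computed in the refined state, the vertex, and that ordering. [cite: Laubner2011, §3.4 step 3 and Thm. 3.4.3 (lexicographic leader)] -/
def cand (W : Finset (Fin k)) (c : Fin k → ℕ) (x : Fin k) : Lex (Code × Lex (ℕ × List (Fin k))) :=
  toLex (code G c (canon R G W (R.refine G W (individualize c x))),
    toLex (x.val, canon R G W (R.refine G W (individualize c x))))

variable {R G} {W : Finset (Fin k)} {c : Fin k → ℕ}

/-- States with at most one vertex are ordered trivially. [folklore] -/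
theorem canon_of_card_le_one (h : W.card ≤ 1) : canon R G W c = W.sort (· ≤ ·) := by
  rw [canon]; simp [h]

/-- **Section nodes**: a disconnected state is ordered by pasting the recursively ordered
components. [cite: Laubner2011, §3.4 step 2] -/
theorem canon_of_not_isConn (hW : ¬ W.card ≤ 1) (h : ¬ IsConn G W c) :
    canon R G W c = paste G c (parts G W c) fun K => if K ∈ parts G W c then canon R G K c else [] := by
  rw [canon]; simp [hW, h]

/-- **Individualization nodes**: a connected state (with a non-singleton cell) is ordered by the
least candidate over the branching cell. [cite: Laubner2011, §3.4 step 3] -/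
theorem canon_of_isConn (hW : ¬ W.card ≤ 1) (h : IsConn G W c) (hA : (bigMinCell W c).Nonempty) :
    canon R G W c = (ofLex (ofLex (((bigMinCell W c).attach.image fun x => cand R G W c x.1).min'
      ((attach_nonempty_iff.2 hA).image _))).2).2 := by
  rw [canon]; simp [hW, h, hA, cand]

/-- The degenerate connected case (every cell a singleton; impossible for equitable states with
two vertices, `IsEqui.two_le_card_cell`). [folklore] -/
theorem canon_of_isConn_of_not_nonempty (hW : ¬ W.card ≤ 1) (h : IsConn G W c) (hA : ¬ (bigMinCell W c).Nonempty) :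
    canon R G W c = W.sort (· ≤ ·) := by
  rw [canon]; simp [hW, h, hA]

/-- The code of a candidate is its first component. [folklore] -/
theorem code_cand (x : Fin k) : code G c (ofLex (ofLex (cand R G W c x)).2).2 = (ofLex (cand R G W c x)).1 := rfl

end CGCanon

end

end Literature.Computability.Complexity
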